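import Summits.Ventures.YMGap.Thresholds.CouplingDerivative
import Summits.Ventures.YMGap.Thresholds.CouplingDerivativeSUN
import Summits.Ventures.YMGap.Thresholds.CouplingDerivativeDim
import Summits.Ventures.YMGap.Thresholds.CouplingContDiff
import Literature.MathematicalPhysics.QuantumFieldTheory.TwistedPartitionFunctionStrict
import Summits.Ventures.YMGap.RobustBall.StringTensionCeilingLinear
import Summits.Ventures.YMGap.RobustBall.PlaquetteLawTwoSided
import Summits.Ventures.YMGap.RobustBall.RowsSU2StarVar
import HarnessLib

/-!
# Venture statement — YMGap (cell `pub-ymgap`) — CONJUNCT BODIES T51 (coupling regularity), T52 (track (b): vortex free energy > 0), T53 (ceiling-side strong-coupling laws), T54 (Y2 lead cell) (seat p3-g6)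

STATUS: STAGED for the lead's V21 booking (bus 2026-08-23T16:16Z). Second of two V21 block files (the first, `StatementConjunctsV21.lean`, carries T49, T50).
Texts: T51 = seat ds-1 g8's five remaining candidate texts (`HOME/ds/ds1g8/lean/V1X-CONJUNCTS-ds1g8.lean` 54034de73e9655cb) VERBATIM; T52 = seat lit-2 g13's
texts T4y / T4y2 (`HOME/lit/lit2-lean/T-texts-lit2g13.lean`, `…g13b.lean`) VERBATIM; T53 = seat rb-p2 g6's seven texts (`HOME/rb/lean-rb-p2/T-texts-rbp2g6.lean`)
VERBATIM; T54 = the TYPES of ds-2 g10's `RowsSU2StarVar` cells (p3's restatement; rb-theory / ds-2 countersign). Only decl names change (`T_X` / `T4y_X` →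
`T5kx_X`); the consolidating conjunctions are p3's. Index entry `YMGapStatementV1_11 := YMGapStatementV1_10 ∧ T49 ∧ … ∧ T54` after both files land.

HONEST FRAMING. WHAT THIS IS: bodies `Tk_… : Prop` + witnesses `Tk_…_holds`, kernel-checked with NO hypothesis, closing by TREE constants only. STRONG-COUPLING
LATTICE statements (T51, T53, T54: `SU(N)` lattice Yang–Mills with the Wilson action / members of the typed balls; every window, radius or constant is where a
BOUND closes, not a transition) and FINITE-TORUS facts about Wilson's theory (T52). WHAT THIS IS NOT: no analyticity (T51 is Lipschitz / `C¹`), no sharp constants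
(T53), nothing about the crossover, scaling, a continuum limit, confinement in the continuum, or the Yang–Mills Millennium problem; T52 says nothing about the
census's truncated character actions.
-/

noncomputable section

namespace Summit.Ventures.YMGap

section T51sec

open MeasureTheory ProbabilityTheory Set
open scoped NNReal ContDiff
open Literature.MathematicalPhysics.QuantumLattice
open Literature.MathematicalPhysics.QuantumFieldTheory hiding ZdEdge Site
open Summit.Ventures.YMGap.CouplingResponse

/-- C-LIP-STAR (state): the `SU(2)` DLR state on `ℤ⁴` is Lipschitz in the Wilson coupling on the whole star window:
for all `0 ≤ β_W, β'_W ≤ 9/25` and every Lipschitz cylinder observable `F` (support `Λ`, constant `K`, links within `D`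
of `x₀`) there is the explicit bound `|⟨F⟩_{β_W} − ⟨F⟩_{β'_W}| ≤ C(D, #Λ K) |β_W − β'_W|` (one constant, displayed in
`su2_abs_integral_sub_integral_le_9_25`; here packaged as `∃ C` depending only on `D`, `#Λ`, `K`). -/
def T51a_SU2StateLipschitzStar : Prop :=
  ∀ (Λ : Finset (ZdEdge 4)) (K : ℝ≥0) (D : ℕ), ∃ C : ℝ,
    ∀ βW βW' : ℝ, 0 ≤ βW → βW ≤ 9 / 25 → 0 ≤ βW' → βW' ≤ 9 / 25 →
    ∀ μ ν : Measure (LGConfig 4 (Matrix.specialUnitaryGroup (Fin 2) ℂ)),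
      μ ∈ ymGibbsMeasures (d := 4) (fundamentalRep (Fin 2)) (2 * (βW / 4)) →
      ν ∈ ymGibbsMeasures (d := 4) (fundamentalRep (Fin 2)) (2 * (βW' / 4)) →
      ∀ (F : LGConfig 4 (Matrix.specialUnitaryGroup (Fin 2) ℂ) → ℝ) (x₀ : Literature.Probability.LatticeModels.Site 4),
        IsLipschitzCylinder (fundamentalRep (Fin 2)) F Λ K → (∀ e ∈ Λ, ‖e.1 - x₀‖ ≤ D) →
          |(∫ U, F U ∂μ) - ∫ U, F U ∂ν| ≤ C * |βW - βW'|

/-- Proof of `T51a_SU2StateLipschitzStar`. -/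
theorem T51a_SU2StateLipschitzStar_holds : T51a_SU2StateLipschitzStar :=
  fun _ _ _ => ⟨_, fun _ _ h0 h h0' h' _ _ hμ hν _ _ hF hD =>
    su2_abs_integral_sub_integral_le_9_25 h0 h h0' h' hμ hν hF hD⟩

/-- C-LIP-STAR (every `SU(N)`, `N ≥ 2`): the DLR states at tree couplings `0 ≤ b, b' ≤ N·9/308` are Lipschitz in the
coupling on every Lipschitz cylinder observable, with one constant depending on `N`, `D`, `#Λ`, `K`. -/
def T51b_SUNStateLipschitzStar : Prop :=
  ∀ N : ℕ, 2 ≤ N → ∀ (Λ : Finset (ZdEdge 4)) (K : ℝ≥0) (D : ℕ), ∃ C : ℝ,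
    ∀ b b' : ℝ, 0 ≤ b → b / N ≤ 9 / 308 → 0 ≤ b' → b' / N ≤ 9 / 308 →
    ∀ μ ν : Measure (LGConfig 4 (Matrix.specialUnitaryGroup (Fin N) ℂ)),
      μ ∈ ymGibbsMeasures (d := 4) (fundamentalRep (Fin N)) b →
      ν ∈ ymGibbsMeasures (d := 4) (fundamentalRep (Fin N)) b' →
      ∀ (F : LGConfig 4 (Matrix.specialUnitaryGroup (Fin N) ℂ) → ℝ) (x₀ : Literature.Probability.LatticeModels.Site 4),
        IsLipschitzCylinder (fundamentalRep (Fin N)) F Λ K → (∀ e ∈ Λ, ‖e.1 - x₀‖ ≤ D) →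
          |(∫ U, F U ∂μ) - ∫ U, F U ∂ν| ≤ C * |b - b'|

/-- Proof of `T51b_SUNStateLipschitzStar`. -/
theorem T51b_SUNStateLipschitzStar_holds : T51b_SUNStateLipschitzStar :=
  fun _ hN _ _ _ => ⟨_, fun _ _ h0 h h0' h' _ _ hμ hν _ _ hF hD =>
    abs_integral_sub_integral_le_SU_thooft hN h0 h h0' h' hμ hν hF hD⟩

/-- C-DIFF (every `SU(N)`, `N ≥ 2`, EVERY DIMENSION `d ≥ 2`): along any DLR selection on `[0, N/(12(d−1))]` (tree coupling;
't Hooft `(d−1) b/N ≤ 1/12`), for every Lipschitz cylinder `F` and every `0 < b < N/(12(d−1))`: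
`d/db ⟨F⟩_b = N · Σ_q Cov_b(F, W_q)` on `ℤ^d`. -/
def T51c_SUNDimCouplingDerivative : Prop :=
  ∀ d N : ℕ, 2 ≤ d → 2 ≤ N → ∀ μ : ℝ → Measure (LGConfig d (Matrix.specialUnitaryGroup (Fin N) ℂ)),
    (∀ b ∈ Icc (0 : ℝ) ((N : ℝ) / (12 * ((d : ℝ) - 1))), μ b ∈ ymGibbsMeasures (d := d) (fundamentalRep (Fin N)) b) →
    ∀ (F : LGConfig d (Matrix.specialUnitaryGroup (Fin N) ℂ) → ℝ) (Λ : Finset (ZdEdge d)) (K : ℝ≥0)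
      (x₀ : Literature.Probability.LatticeModels.Site d) (D : ℕ),
      IsLipschitzCylinder (fundamentalRep (Fin N)) F Λ K → (∀ e ∈ Λ, ‖e.1 - x₀‖ ≤ D) →
      ∀ b ∈ Ioo (0 : ℝ) ((N : ℝ) / (12 * ((d : ℝ) - 1))),
        HasDerivAt (fun t => ∫ U, F U ∂(μ t))
          ((N : ℝ) * ∑' q : ZdPlaquette d, cov[F, zdPlaquetteObs (fundamentalRep (Fin N)) q.1 q.2.1.1 q.2.1.2; μ b]) b

/-- Proof of `T51c_SUNDimCouplingDerivative`. -/
theorem T51c_SUNDimCouplingDerivative_holds : T51c_SUNDimCouplingDerivative :=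
  fun _ _ hd hN _ hμ _ _ _ _ _ hF hD _ hb => hasDerivAt_integral_dim_thooft hd hN hμ hF hD hb

/-- C¹ (literal `ContDiffOn ℝ 1`): `SU(2)`, `d = 4` — along any DLR selection on `[0, 9/25]`, for every Lipschitz cylinder
observable `F`, `β_W ↦ ⟨F⟩_{β_W}` is continuously differentiable on the open window `(0, 9/25)`. -/
def T51d_SU2StateC1 : Prop :=
  ∀ μ : ℝ → Measure (LGConfig 4 (Matrix.specialUnitaryGroup (Fin 2) ℂ)),
    (∀ βW ∈ Icc (0 : ℝ) (9 / 25), μ βW ∈ ymGibbsMeasures (d := 4) (fundamentalRep (Fin 2)) (2 * (βW / 4))) →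
    ∀ (F : LGConfig 4 (Matrix.specialUnitaryGroup (Fin 2) ℂ) → ℝ) (Λ : Finset (ZdEdge 4)) (K : ℝ≥0)
      (x₀ : Literature.Probability.LatticeModels.Site 4) (D : ℕ),
      IsLipschitzCylinder (fundamentalRep (Fin 2)) F Λ K → (∀ e ∈ Λ, ‖e.1 - x₀‖ ≤ D) →
        ContDiffOn ℝ 1 (fun t => ∫ U, F U ∂(μ t)) (Ioo (0 : ℝ) (9 / 25))

/-- Proof of `T51d_SU2StateC1`. -/
theorem T51d_SU2StateC1_holds : T51d_SU2StateC1 :=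
  fun _ hμ _ _ _ _ _ hF hD => su2_contDiffOn_integral_9_25 hμ hF hD

/-- C¹ (literal `ContDiffOn ℝ 1`): every `SU(N)`, `N ≥ 2`, every `d ≥ 2` — along any DLR selection on `[0, N/(12(d−1))]`, for
every Lipschitz cylinder observable `F` of `ℤ^d`, `b ↦ ⟨F⟩_b` is continuously differentiable on `(0, N/(12(d−1)))`. -/
def T51e_SUNDimStateC1 : Prop :=
  ∀ d N : ℕ, 2 ≤ d → 2 ≤ N → ∀ μ : ℝ → Measure (LGConfig d (Matrix.specialUnitaryGroup (Fin N) ℂ)),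
    (∀ b ∈ Icc (0 : ℝ) ((N : ℝ) / (12 * ((d : ℝ) - 1))), μ b ∈ ymGibbsMeasures (d := d) (fundamentalRep (Fin N)) b) →
    ∀ (F : LGConfig d (Matrix.specialUnitaryGroup (Fin N) ℂ) → ℝ) (Λ : Finset (ZdEdge d)) (K : ℝ≥0)
      (x₀ : Literature.Probability.LatticeModels.Site d) (D : ℕ),
      IsLipschitzCylinder (fundamentalRep (Fin N)) F Λ K → (∀ e ∈ Λ, ‖e.1 - x₀‖ ≤ D) →
        ContDiffOn ℝ 1 (fun t => ∫ U, F U ∂(μ t)) (Ioo (0 : ℝ) ((N : ℝ) / (12 * ((d : ℝ) - 1))))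

/-- Proof of `T51e_SUNDimStateC1`. -/
theorem T51e_SUNDimStateC1_holds : T51e_SUNDimStateC1 :=
  fun _ _ hd hN _ hμ _ _ _ _ _ hF hD => contDiffOn_integral_dim_thooft hd hN hμ hF hD


/-- **T51 — strong coupling: THE DLR STATE IS LIPSCHITZ AND `C¹` IN THE COUPLING — the C-LIP-STAR rows, C-DIFF in EVERY dimension, and literal `ContDiffOn ℝ 1`, HYPOTHESIS-FREE** (seat ds-1 g8 texts `HOME/ds/ds1g8/lean/V1X-CONJUNCTS-ds1g8.lean`, the five not used in T42, VERBATIM as the parts above): (a) `SU(2)` `ℤ⁴`: `|⟨F⟩_{β_W} − ⟨F⟩_{β'_W}| ≤ C·|β_W − β'_W|` on the whole star window `[0, 9/25]`, one constant per `(D, #Λ, K)`; (b) every `SU(N)` at 't Hooft `≤ 9/308`; (c) every `SU(N)`, every `d ≥ 2`: `d/db ⟨F⟩_b = N·Σ_q Cov_b(F, W_q)` on `(0, N/(12(d−1)))`; (d)/(e) literal `ContDiffOn ℝ 1` of `b ↦ ⟨F⟩_b` on the open windows (`SU(2)` `ℤ⁴`; every `N`, `d`). HONEST LABEL: Lipschitz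 / `C¹` on cylinder observables — NOT analyticity, not `C²`; lattice strong coupling; nothing continuum. -/
def T51_CouplingLipschitzC1 : Prop :=
  T51a_SU2StateLipschitzStar ∧ T51b_SUNStateLipschitzStar ∧ T51c_SUNDimCouplingDerivative ∧ T51d_SU2StateC1 ∧ T51e_SUNDimStateC1

/-- T51 holds (the parts above, each closed by the owner's tree theorem). -/
theorem T51_CouplingLipschitzC1_holds : T51_CouplingLipschitzC1 :=
  ⟨T51a_SU2StateLipschitzStar_holds, T51b_SUNStateLipschitzStar_holds, T51c_SUNDimCouplingDerivative_holds, T51d_SU2StateC1_holds,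
    T51e_SUNDimStateC1_holds⟩

end T51sec

section T52sec

open Literature.MathematicalPhysics.QuantumLattice
open Literature.MathematicalPhysics.QuantumFieldTheory

/-- **T52a (seat lit-2's T4y) — track (b): THE VORTEX FREE ENERGY OF WILSON'S THEORY IS STRICTLY POSITIVE ON EVERY FINITE TORUS OF SIDE
`2^(n+1)` AT EVERY `β ≠ 0`** (Tomboulis 2007 Prop. IV.1, strict clause, for every compact gauge group with a centre element
acting non-trivially; and its `SU(2)` instance). -/
def T52a_VortexFreeEnergyPositive : Prop :=
  (∀ (d L N n : ℕ) [NeZero d] [NeZero L] [NeZero N] (G : Type) [Group G] [TopologicalSpace G]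
      [IsTopologicalGroup G] [CompactSpace G] [MeasurableSpace G] [BorelSpace G]
      (ρ : G →* Matrix (Fin N) (Fin N) ℂ), Continuous ρ → L = 2 ^ (n + 1) →
      ∀ (β : ℝ), β ≠ 0 → ∀ (j : Fin d) (hj : (0 : Fin d) < j) (z : G), z ∈ Subgroup.center G →
      ∀ (ω : ℂ), ρ z = ω • (1 : Matrix (Fin N) (Fin N) ℂ) → ‖ω‖ = 1 → ω ≠ 1 →
        twistedPartitionFunction ρ β L z ⟨(0, j), hj⟩ < twistedPartitionFunction ρ β L 1 ⟨(0, j), hj⟩) ∧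
  (∀ (d L n : ℕ) [NeZero d] [NeZero L], L = 2 ^ (n + 1) → ∀ (β : ℝ), β ≠ 0 →
      ∀ (j : Fin d) (hj : (0 : Fin d) < j),
        twistedPartitionFunction (fundamentalRep (Fin 2)) β L Tomboulis2007.negOne ⟨(0, j), hj⟩ <
          twistedPartitionFunction (fundamentalRep (Fin 2)) β L 1 ⟨(0, j), hj⟩)

/-- T52a holds (`twistedPartitionFunction_lt_untwisted`, `su2_twistedPartitionFunction_lt_untwisted`). -/
theorem T52a_VortexFreeEnergyPositive_holds : T52a_VortexFreeEnergyPositive :=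
  ⟨fun _ _ _ n _ _ _ _ _ _ _ _ _ _ ρ hρ hL _ hβ _ hj _ hz _ hω hω1 hne =>
      twistedPartitionFunction_lt_untwisted ρ n hL hρ hβ hj hz hω hω1 hne,
    fun _ _ n _ _ hL _ hβ _ hj => su2_twistedPartitionFunction_lt_untwisted n hL hβ hj⟩

/-- **T52b (seat lit-2's T4y2) — track (b): THE VORTEX FREE ENERGY OF WILSON'S THEORY IS STRICTLY POSITIVE ON EVERY FINITE TORUS OF SIDE
`2^(n+1)`, IN EVERY PLANE, AT EVERY `β ≠ 0`** — (i) every compact gauge group with a centre element acting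
non-trivially; (ii) `SU(N)`, every `N`, every non-trivial centre element. -/
def T52b_VortexFreeEnergyPositiveEveryPlane : Prop :=
  (∀ (d L N n : ℕ) [NeZero d] [NeZero L] [NeZero N] (G : Type) [Group G] [TopologicalSpace G]
      [IsTopologicalGroup G] [CompactSpace G] [MeasurableSpace G] [BorelSpace G]
      (ρ : G →* Matrix (Fin N) (Fin N) ℂ), Continuous ρ → L = 2 ^ (n + 1) →
      ∀ (β : ℝ), β ≠ 0 → ∀ (q : {p : Fin d × Fin d // p.1 < p.2}) (z : G), z ∈ Subgroup.center G →
      ∀ (ω : ℂ), ρ z = ω • (1 : Matrix (Fin N) (Fin N) ℂ) → ‖ω‖ = 1 → ω ≠ 1 →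
        twistedPartitionFunction ρ β L z q < twistedPartitionFunction ρ β L 1 q) ∧
  (∀ (d L N n : ℕ) [NeZero d] [NeZero L] [NeZero N], L = 2 ^ (n + 1) → ∀ (β : ℝ), β ≠ 0 →
      ∀ (q : {p : Fin d × Fin d // p.1 < p.2}) (k : ZMod N), k ≠ 0 →
        twistedPartitionFunction (fundamentalRep (Fin N)) β L
            (suCenter N k : Matrix.specialUnitaryGroup (Fin N) ℂ) q <
          twistedPartitionFunction (fundamentalRep (Fin N)) β L 1 q)

/-- T52b holds (`twistedPartitionFunction_lt_untwisted_plane`, `suN_twistedPartitionFunction_lt_untwisted_plane`). -/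
theorem T52b_VortexFreeEnergyPositiveEveryPlane_holds : T52b_VortexFreeEnergyPositiveEveryPlane :=
  ⟨fun _ _ _ n _ _ _ _ _ _ _ _ _ _ ρ hρ hL _ hβ q _ hz _ hω hω1 hne =>
      twistedPartitionFunction_lt_untwisted_plane ρ n hL hρ hβ q hz hω hω1 hne,
    fun _ _ _ n _ _ _ hL _ hβ q _ hk => suN_twistedPartitionFunction_lt_untwisted_plane n hL hβ q hk⟩

/-- **T52 — track (b): THE VORTEX ('t Hooft electric-flux) FREE ENERGY OF WILSON'S THEORY IS STRICTLY POSITIVE ON EVERY FINITE TORUS OF SIDE `2^(n+1)` AT EVERY `β ≠ 0`** — Tomboulis 2007 Prop. IV.1 STRICT clause for the WILSON action (seat lit-2 g13 texts `HOME/lit/lit2-lean/T-texts-lit2g13.lean` (T4y) and `T-texts-lit2g13b.lean` (T4y2) VERBATIM as the parts above): every compact `G` with a central element acting by `ω ≠ 1`, one plane `(0, j)` resp. EVERY plane `(μ, ν)`, and the `SU(N)` instances for every non-trivial centre element. HONEST RESIDUE: `Z⁻ < Z` for the census's TRUNCATED character actions `torusZtw` and side lengths not a power of two are NOT typed (only `≤`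 / `0 < Z⁻` are theorems there); finite tori; nothing about rates in `L`, confinement or (5.15)/(5.16). -/
def T52_VortexFreeEnergyPositive : Prop :=
  T52a_VortexFreeEnergyPositive ∧ T52b_VortexFreeEnergyPositiveEveryPlane

/-- T52 holds (the parts above, each closed by the owner's tree theorem). -/
theorem T52_VortexFreeEnergyPositive_holds : T52_VortexFreeEnergyPositive :=
  ⟨T52a_VortexFreeEnergyPositive_holds, T52b_VortexFreeEnergyPositiveEveryPlane_holds⟩

end T52sec

section T53sec

open MeasureTheory
open Literature.MathematicalPhysics.QuantumLattice Literature.MathematicalPhysics.QuantumFieldTheory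

/-- «THE SU(2) STRING-TENSION CEILING WITHOUT A CONSTANT, d = 4»: for every `β_W > 0` and every infinite-volume
limit point `μ` of the SU(2) torus Wilson states at tree coupling `β_W/2`, `σ(μ) ≤ log(4/β_W) + 54β_W`
(`RobustBall.StringTensionExplicit.su2_stringTension_le_log4_linear_dim4`; `log(4/β_W)` = leading term of the strong-coupling series). -/
def T53a_SU2StringTensionCeilingLinearDim4 : Prop :=
  ∀ βW : ℝ, 0 < βW →
    ∀ μ ∈ infiniteVolumeLimitPoints (d := 4) (fundamentalRep (Fin 2)) (βW / 2),
      stringTension μ (fun g => normalisedCharacter 2 (fundamentalRep (Fin 2) g)) ≤ Real.log (4 / βW) + 54 * βW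

/-- `T53a_SU2StringTensionCeilingLinearDim4` holds. -/
theorem T53a_SU2StringTensionCeilingLinearDim4_holds : T53a_SU2StringTensionCeilingLinearDim4 :=
  fun _βW hβ _μ hμ => RobustBall.StringTensionExplicit.su2_stringTension_le_log4_linear_dim4 hβ hμ

/-- «THE SU(2) STRONG-COUPLING LAW WITH A VANISHING CEILING LOSS, d = 4»: for every `0 < β_W ≤ 2/3` and every
infinite-volume limit point `μ` at tree coupling `β_W/2`, `log(4/β_W) − log 6 ≤ σ(μ) ≤ log(4/β_W) + 54β_W`
(`RobustBall.StringTensionExplicit.su2_stringTension_two_sided_linear_dim4`; floor = Dobrushin door, ceiling = sequential private-link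
resampling). -/
def T53b_SU2StringTensionLawVanishingCeilingDim4 : Prop :=
  ∀ βW : ℝ, 0 < βW → βW ≤ 2 / 3 →
    ∀ μ ∈ infiniteVolumeLimitPoints (d := 4) (fundamentalRep (Fin 2)) (βW / 2),
      Real.log (4 / βW) - Real.log 6 ≤ stringTension μ (fun g => normalisedCharacter 2 (fundamentalRep (Fin 2) g)) ∧
        stringTension μ (fun g => normalisedCharacter 2 (fundamentalRep (Fin 2) g)) ≤ Real.log (4 / βW) + 54 * βW

/-- `T53b_SU2StringTensionLawVanishingCeilingDim4` holds. -/
theorem T53b_SU2StringTensionLawVanishingCeilingDim4_holds : T53b_SU2StringTensionLawVanishingCeilingDim4 :=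
  fun _βW hβ hβ1 _μ hμ => RobustBall.StringTensionExplicit.su2_stringTension_two_sided_linear_dim4 hβ hβ1 hμ

/-- «THE CEILING-SIDE LOSS VANISHES AS β_W → 0, UNIFORMLY OVER THE LIMIT STATES» (SU(2), d = 4):
`∀ ε > 0, ∃ β₀ > 0, ∀ β_W ∈ (0, β₀], ∀ μ, σ(μ) ≤ log(4/β_W) + ε` (`RobustBall.StringTensionExplicit.su2_stringTension_ceiling_limit_dim4`). -/
def T53c_SU2StringTensionCeilingLimitDim4 : Prop :=
  ∀ ε : ℝ, 0 < ε → ∃ β₀ : ℝ, 0 < β₀ ∧ ∀ βW : ℝ, 0 < βW → βW ≤ β₀ →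
    ∀ μ ∈ infiniteVolumeLimitPoints (d := 4) (fundamentalRep (Fin 2)) (βW / 2),
      stringTension μ (fun g => normalisedCharacter 2 (fundamentalRep (Fin 2) g)) ≤ Real.log (4 / βW) + ε

/-- `T53c_SU2StringTensionCeilingLimitDim4` holds. -/
theorem T53c_SU2StringTensionCeilingLimitDim4_holds : T53c_SU2StringTensionCeilingLimitDim4 :=
  fun ε hε => RobustBall.StringTensionExplicit.su2_stringTension_ceiling_limit_dim4 ε hε

/-- «THE MEAN-PLAQUETTE LAW OF SU(2) LATTICE YANG–MILLS, d = 4»: for every `β_W > 0` and every infinite-volume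
limit point `μ` at tree coupling `β_W/2`, `|log W_μ(1,1) − log(β_W/4)| ≤ 72β_W` — the mean plaquette of EVERY limit state is the leading
strong-coupling term `u = β_W/4` up to a factor `e^{∓O(β_W)}` (`RobustBall.PlaquetteLaw.su2_abs_log_plaquette_sub_log_le_dim4`;
lower side −54β_W, upper side +72β_W, `su2_log_plaquette_two_sided_dim4`). -/
def T53d_SU2MeanPlaquetteLawDim4 : Prop :=
  ∀ βW : ℝ, 0 < βW →
    ∀ μ ∈ infiniteVolumeLimitPoints (d := 4) (fundamentalRep (Fin 2)) (βW / 2),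
      |Real.log (rectExpectation μ (fun g => normalisedCharacter 2 (fundamentalRep (Fin 2) g)) 0 1 1 1) - Real.log (βW / 4)| ≤
        72 * βW

/-- `T53d_SU2MeanPlaquetteLawDim4` holds. -/
theorem T53d_SU2MeanPlaquetteLawDim4_holds : T53d_SU2MeanPlaquetteLawDim4 :=
  fun _βW hβ _μ hμ => RobustBall.PlaquetteLaw.su2_abs_log_plaquette_sub_log_le_dim4 hβ hμ

/-- «THE MEAN PLAQUETTE OF EVERY LIMIT STATE IS ASYMPTOTIC TO WILSON'S LEADING TERM» (SU(2), d = 4):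
`∀ ε > 0, ∃ β₀ > 0, ∀ β_W ∈ (0, β₀], ∀ μ, |W_μ(1,1)/(β_W/4) − 1| ≤ ε` (`RobustBall.PlaquetteLaw.su2_plaquette_ratio_limit_dim4`). -/
def T53e_SU2MeanPlaquetteLimitDim4 : Prop :=
  ∀ ε : ℝ, 0 < ε → ∃ β₀ : ℝ, 0 < β₀ ∧ ∀ βW : ℝ, 0 < βW → βW ≤ β₀ →
    ∀ μ ∈ infiniteVolumeLimitPoints (d := 4) (fundamentalRep (Fin 2)) (βW / 2),
      |rectExpectation μ (fun g => normalisedCharacter 2 (fundamentalRep (Fin 2) g)) 0 1 1 1 / (βW / 4) - 1| ≤ ε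

/-- `T53e_SU2MeanPlaquetteLimitDim4` holds. -/
theorem T53e_SU2MeanPlaquetteLimitDim4_holds : T53e_SU2MeanPlaquetteLimitDim4 :=
  fun ε hε => RobustBall.PlaquetteLaw.su2_plaquette_ratio_limit_dim4 ε hε

/-- «THE MEAN-PLAQUETTE LAW FOR EVERY SU(N), N ≥ 3, d = 4»: for every tree coupling `β > 0` and every infinite-volume
limit point, `−54Nβ ≤ log W_μ(1,1) − log(β/(2N)) ≤ 72Nβ` (`β/(2N) = β_W/(2N²) = u`)
(`RobustBall.PlaquetteLaw.suN_log_plaquette_two_sided_dim4`). -/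
def T53f_SUNMeanPlaquetteLawDim4 : Prop :=
  ∀ N : ℕ, 3 ≤ N → ∀ β : ℝ, 0 < β →
    ∀ μ ∈ infiniteVolumeLimitPoints (d := 4) (fundamentalRep (Fin N)) β,
      -(54 * N * β) ≤ Real.log (rectExpectation μ (fun g => normalisedCharacter N (fundamentalRep (Fin N) g)) 0 1 1 1) -
          Real.log (β / (2 * N)) ∧
        Real.log (rectExpectation μ (fun g => normalisedCharacter N (fundamentalRep (Fin N) g)) 0 1 1 1) -
          Real.log (β / (2 * N)) ≤ 72 * N * β

/-- `T53f_SUNMeanPlaquetteLawDim4` holds. -/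
theorem T53f_SUNMeanPlaquetteLawDim4_holds : T53f_SUNMeanPlaquetteLawDim4 :=
  fun _N hN _β hβ _μ hμ => RobustBall.PlaquetteLaw.suN_log_plaquette_two_sided_dim4 hN hβ hμ

/-- «THE EVERY-N STRING-TENSION CEILING WITHOUT A CONSTANT, d = 4»: for every `N ≥ 2`, every tree coupling `β > 0` and
every infinite-volume limit point, `σ(μ) ≤ log(2N/β) + 54Nβ` (`RobustBall.StringTensionExplicit.suN_stringTension_le_log_linear_dim4`). -/
def T53g_SUNStringTensionCeilingLinearDim4 : Prop :=
  ∀ N : ℕ, 2 ≤ N → ∀ β : ℝ, 0 < β →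
    ∀ μ ∈ infiniteVolumeLimitPoints (d := 4) (fundamentalRep (Fin N)) β,
      stringTension μ (fun g => normalisedCharacter N (fundamentalRep (Fin N) g)) ≤ Real.log (2 * N / β) + 54 * N * β

/-- `T53g_SUNStringTensionCeilingLinearDim4` holds. -/
theorem T53g_SUNStringTensionCeilingLinearDim4_holds : T53g_SUNStringTensionCeilingLinearDim4 :=
  fun _N hN _β hβ _μ hμ => RobustBall.StringTensionExplicit.suN_stringTension_le_log_linear_dim4 hN hβ hμ

/-- **T53 — WILSON ACTION, STRONG COUPLING: THE CEILING-SIDE LAWS — `σ ≤` a LINEAR ceiling, the string-tension law with VANISHING ceiling-side constant, the two-sided MEAN-PLAQUETTE law and its limit, for `SU(2)` and every `SU(N)`, `d = 4`** (seat rb-p2 g6 texts `HOME/rb/lean-rb-p2/T-texts-rbp2g6.lean` VERBATIM as the parts above; `RobustBall/StringTensionCeilingLinear.lean` 1922d85d9809, `PlaquetteLawTwoSided.lean` 0cc6ddf447bd). Statements about the unperturbed Wilson action and the infinite-volume limit points of its torus states; complements T47 (floor + O(1) law). HONEST LABEL: leading coefficients exact, constants one-link / door artefacts; nothing about the crossover,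 scaling or the continuum. -/
def T53_StrongCouplingCeilingLaws : Prop :=
  T53a_SU2StringTensionCeilingLinearDim4 ∧ T53b_SU2StringTensionLawVanishingCeilingDim4 ∧ T53c_SU2StringTensionCeilingLimitDim4 ∧
    T53d_SU2MeanPlaquetteLawDim4 ∧ T53e_SU2MeanPlaquetteLimitDim4 ∧ T53f_SUNMeanPlaquetteLawDim4 ∧ T53g_SUNStringTensionCeilingLinearDim4

/-- T53 holds (the parts above, each closed by the owner's tree theorem). -/
theorem T53_StrongCouplingCeilingLaws_holds : T53_StrongCouplingCeilingLaws :=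
  ⟨T53a_SU2StringTensionCeilingLinearDim4_holds, T53b_SU2StringTensionLawVanishingCeilingDim4_holds,
    T53c_SU2StringTensionCeilingLimitDim4_holds, T53d_SU2MeanPlaquetteLawDim4_holds, T53e_SU2MeanPlaquetteLimitDim4_holds,
    T53f_SUNMeanPlaquetteLawDim4_holds, T53g_SUNStringTensionCeilingLinearDim4_holds⟩

end T53sec

section T54sec

open Summit.Ventures.YMGap.RobustBall

/-- **T54 — track Y2: THE LEAD CELL OF THE SIGNED DATA CUT (2026-08-23T14:00Z §0/§2) AND ITS `SU(2)` LADDER — the mass gap UNIFORMLY on the gauge-invariant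
tier-1 `ℤ⁴` ball through the VARIANCE-FORM robust star door, HYPOTHESIS-FREE** (seat ds-2 g10 W20, `RobustBall/RowsSU2StarVar.lean` 73831475863d; the bodies
below are the TYPES of the named tree theorems, one cell each; `MassGapOnBallZdG 4 2 (β_W/4) ε₀ ε₁ R` = for every gauge-invariant finite-range-`R` member `W`
of the ball with site-incidence loads `(ε₀, ε₁)`: ONE DLR state and exponential clustering, cf. T36): (i) the LEAD CELL `(β⋆_W, ε) = (1/8, 0.223)`:
`MassGapOnBallZdG 4 2 (1/32) (223/500) (223/1000) R` for every `R` (`su2_massGapOnBallZdG_starVar_oneEighth`; supersedes T36 (i)'s `(1/8, 0.148)` cell as the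
lead cell — T36 stays true on its sub-ball); (ii)–(v) the ladder `(1/16, .309)`, `(1/10, .256)`, `(1/6, .17)`, `(1/5, .129)`
(`su2_massGapOnBallZdG_starVar_oneSixteenth/_oneTenth/_oneSixth/_oneFifth`). HONEST LABEL: radii are door artefacts (where the variance-form star bound
closes); strong coupling only; nothing about `β_W` beyond the ladder, the crossover or the continuum. -/
def T54_SU2LeadCellStarVar : Prop :=
  (∀ R : ℕ, MassGapOnBallZdG 4 2 (1 / 32) (223 / 500) (223 / 1000) R) ∧
  (∀ R : ℕ, MassGapOnBallZdG 4 2 (1 / 64) (309 / 500) (309 / 1000) R) ∧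
  (∀ R : ℕ, MassGapOnBallZdG 4 2 (1 / 40) (64 / 125) (32 / 125) R) ∧
  (∀ R : ℕ, MassGapOnBallZdG 4 2 (1 / 24) (17 / 50) (17 / 100) R) ∧
  (∀ R : ℕ, MassGapOnBallZdG 4 2 (1 / 20) (129 / 500) (129 / 1000) R)

/-- T54 holds (`su2_massGapOnBallZdG_starVar_oneEighth/_oneSixteenth/_oneTenth/_oneSixth/_oneFifth`). -/
theorem T54_SU2LeadCellStarVar_holds : T54_SU2LeadCellStarVar :=
  ⟨su2_massGapOnBallZdG_starVar_oneEighth, su2_massGapOnBallZdG_starVar_oneSixteenth, su2_massGapOnBallZdG_starVar_oneTenth,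
    su2_massGapOnBallZdG_starVar_oneSixth, su2_massGapOnBallZdG_starVar_oneFifth⟩

end T54sec

end Summit.Ventures.YMGap

end
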